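import Summits.HodgeConjecture.HodgeConjecture.Theorems.F0P2rCuspDictHolds                  -- ★ CUSP-DICT bricks: `isSupercuspidal_comp_toMonoidHom_iff`; pulls ★ `F0P2rFamTransferHolds` (`isConstituentOf_of_isotypicComponent_eq_top`), ★ `F0P2cOmegaLocalType`, ★ `F0P2cStubCI`, ★ `F0P3FinPartIsotypic`, ★ `F0P2oGR90Prop522OfLetters`, ★ `F0P2oLocalLettersHold` (#76, N3), ★ `F0P2oK1aWOfLetters`
import Summits.HodgeConjecture.HodgeConjecture.Theorems.F0P2oXThetaOwnClass                   -- ★ K1c `stubK1c_holds` (the transported theta type is irreducible and smooth at EVERY line)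
import Summits.HodgeConjecture.HodgeConjecture.Theorems.F0P2nFrobeniusFunctional               -- ★ K1b `isConstituentOf_mk_cmPrincipalSeries_xi_of_functional`
import Summits.HodgeConjecture.HodgeConjecture.Theorems.F0P2oK1wOfWeylConj                     -- ★ `stubK1w_of_weylConj (hW)` (Weyl symmetry in `cmXiTorusChar` currency)
import Summits.HodgeConjecture.HodgeConjecture.Theorems.F0P2pK1wHolds                          -- ★ K1w `cmPrincipalSeries_isConstituentOf_weylConj_holds` (hypothesis-free)
import Summits.HodgeConjecture.HodgeConjecture.Theorems.F0P2oStubDictTorusChar                 -- ★ K2 `stubDictTorusChar_holds` (the local dictionary `χ_ξ = χθ` under the two pins)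
import Summits.HodgeConjecture.HodgeConjecture.Theorems.F0P2oBorelEigenfunctionalOfJacquetModule -- ★ N3ᵟ `thetaType_nonsplit_borelEigenfunctional_of_jacquetModule` (⟸ N3 ★)
import Literature.NumberTheory.Automorphic.Liu2021.CheckOfChi                                  -- ★ `HeckeCharacter.checkOfChi`, `checkOfChi_apply`, `idelicFinPart`
import HarnessLib

/-!
# Crux `H413`, programme P2 — road «S2♯-θ» FILE 2: the NON-SPLIT membership clause of `MemXiFamily` for a discrete `P` with a THETA finite component
# (`P_f ↩ ω_H(μ, a, χ)`), for the forward-dictionary `ξ` of ★ `F0P2uXiOfThetaDatum` (desk F0P2-plan (g13) RULING D-P2-15)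

Cell hodgecm-mathlib (D-0151), FLOOR 0, crux item H413 = stmt-HodgeConjecture-24833, programme P2 (theta ∕ `hdictE`); seat F0P2-p06 (g9).  ROAD «S2♯-θ»
(FINDING 2026-09-01T15:01Z, RULING D-P2-15 15:13Z): the REL-ENGINE head `F0P2E3RelEngine.relParity_of_engine` consumes the print letter S2♯ #80 only through its
FINITE clause at THETA-type `P` — the letter `StubS2SharpTheta` («`P.HasFinComponent (ω_H(μ,a,χ)) ⟹ ∃ ξ, MemXiFamily P … μω hμu ξ`», HOME
`F0/P2/e2-ed4-s2theta-src.F0P2-plan-g13/StubS2SharpTheta.letter…txt` 8a360cce8c483c16).  FILE 1 = ★ p845114 `F0P2uXiOfThetaDatum` (the forward dictionary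
`(μ, χ, μω) ↦ ξ`); FILE 2 = THIS FILE (non-split places); FILE 3 (split places) + FILE 4 (assembly `∃ Pv, IsXiLocalFamily ∧ LocalConstituentsIn`) = F0P2-p01 (g13).
THEOREMS ONLY (no `def`, no instance, no notation, no named fact, no `sorry`); no `Cruxes/…/Lines` import (O50-1); kernel lane `--supports stmt-HodgeConjecture-24833`.
HONEST LABEL: HC_CM is proved only modulo the 2 remaining named inputs (hLiu418, h413) until rung 0 closes; every print input used here is a ★ THEOREM of the tree
(N3 #96 ★ `thetaType_nonsplit_jacquetModule_holds`, N6 ★, K1w #98 ★, U′-N #76 ★ `GR91Lemma512NonsplitAsPrinted_holds`) — nothing printed is assumed.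

## THE STATEMENT (`nonsplit_clause_of_hasFinComponent_theta`)
Frame `(H, hH, hHd, e₁, dV, g, ιV)` (`ιV k = g_f⁻¹ k g_f`), automorphic measure `μA`, discrete automorphic `P` of `U(H)` with `P_f ↩ ω_H(μ, a, χ)` (★ `HasFinComponent` of ★
`rhoAtLine … ιV a χ`, the REL¹ telescope verbatim), Rogawski's `μω` (`hμu`, `hquad`), and ANY `ξ : OneDimAutRepH L` under the two GLOBAL dictionary pins of ★ FILE 1
(`toHeckeCharacter μ = ξ.bcη⁻¹·ξ.bcψ⁻¹·μω`, `χ̌ = ξ.bcψ⁻¹·(ξ.bcη⁻¹ξ.bcψ⁻¹μω)²`).  At a NON-split place `v`: there are a form congruence `ᵗT̄ H_v T = a′Φ₃` and a pair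
`(x, s)` — `x : IrrClass (Gqs L v)` a constituent of the principal series `i_G(χ_{ξ,v})` (`cmXiTorusChar L v μω_v η_v ψ_v`), `s` an optional SUPERCUSPIDAL class of `U(H)(L⁺_v)`
— such that EVERY local constituent `c` of `P` at `v` (D6 currency: `comap (localPiEquiv v) c ∈ JH(P_f^∞ ∘ inclPlace v)`) is `πⁿ := comap (cmDatumLocalCongr …)⁻¹ x` or `πˢ := s`:
exactly the non-split clause of ★ `IsXiLocalFamily` for `Pv v := ⟨πⁿ, πˢ⟩` together with the `LocalConstituentsIn` clause at `v` (★ `LocalAPacket.mem_members_iff`).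

## THE PROOF (all ★)
* (Flath + Liu, as in ★ CUSP-DICT §2) every local constituent of `P` at `v` is a constituent of the IRREDUCIBLE local type `τ_a = X_v(μ,a,χ) ∘ κ_v⁻¹` of `ω_H(a) ∘ inclPlace v`
  (★ `isotypicComponent_finRep_smoothPart_eq_top`, ★ `isLocalTypeAt_rhoAtLine_chi`, ★ `isConstituentOf_of_isotypicComponent_eq_top`), hence EQUALS the class
  `c_a := comap (cmDatumLocalCongr …)⁻¹ ⟦πG_a⟧` of the K1 composite `πG_a = X_v(μ,a,χ) ∘ κ_v⁻¹ ∘ (congr_T)` (★ K1c: irreducible and smooth at EVERY line; its pull-back along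
  `localPiEquiv v` IS `τ_a` as a function — `e ∘ e⁻¹ = id` — so both classes are constituents of the irreducible `τ_a` and coincide, ★ `eq_of_isIrreducible` + `comap_injective`).
* Case `X_v(μ,a,χ)` SUPERCUSPIDAL: `πˢ := some c_a` (supercuspidality transports along the two congruences, ★ `isSupercuspidal_comp_toMonoidHom_iff`, ★ `IsSupercuspidal.comap`),
  `πⁿ := ` the constituent `x₀ ∈ JH(i_G(χ_ξ))` of ★ #76 at the pins (★ `GR91Lemma512NonsplitAsPrinted_holds`).
* Case NOT supercuspidal: `πˢ := none`, `πⁿ := c_a` with `⟦πG_a⟧ ∈ JH(i_G(χ_ξ))` by THE K1 CHAIN AT THE GIVEN LINE `a` — a line-independent centre character `ψθ`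
  (★ `exists_forall_isThetaCenterChar`); non-supercuspidal ⟹ `ψθ` OCCURS in `ω¹_a` ([GelbartRogawski1990 Prop. 5.2.2] ★ `GR90Prop522_of_letters` at N3 ★, N6 ★); N3ᵟ ★ gives the
  non-zero `(B, χθʷ·δ_B^{1/2})`-eigenfunctional on `πG_a`; K1b ★ Frobenius puts `⟦πG_a⟧` in `JH(i_G(χθʷ))`, K1w ★ in `JH(i_G(χθ))`, and the K2 ★ dictionary at the pins reads
  `i_G(χθ) = i_G(χ_ξ)` (`cmXiTorusChar L v μω_v η_v ψ_v = cmXiTorusChar L v μ_v ψθ⁻¹ ψθ`).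

## References
* [Rogawski1990] J. Rogawski, Ann. of Math. Stud. 123 (1990): §12.2 (2) p. 174; §13.1 p. 199, Prop. 13.1.3 (d); §13.3 p. 201.
* [GelbartRogawski1991] S. Gelbart, J. Rogawski, Invent. Math. 105 (1991): §5.1 (5.1.1) p. 465, Lem. 5.1.2 pp. 465–466; §5.2 p. 467.
* [GelbartRogawski1990] S. Gelbart, J. Rogawski, Festschrift Piatetski-Shapiro (1990): Prop. 5.2.2.
* [Flath1979] D. Flath, PSPM 33.1: Thm. 3.  [BushnellHenniart2006] §1.1, §2, §10.1.  [Liu2021] Def. 4.11 (l. 2090–2096); App. D §D.1 (l. 5224).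
-/

set_option autoImplicit false
-- the mandated namespace repeats the single-problem summit's segment (`HodgeConjecture.HodgeConjecture`)
set_option linter.dupNamespace false

noncomputable section

open scoped Matrix Kronecker MatrixGroups MonoidAlgebra ComplexOrder
open NumberField NumberField.InfinitePlace IsDedekindDomain MeasureTheory
open Literature.NumberTheory Literature.NumberTheory.Automorphic Literature.NumberTheory.Automorphic.UnitaryGroup
open Literature.NumberTheory.Automorphic.UnitaryGroup.CotangentForms
open Literature.NumberTheory.Automorphic.Liu2021 Literature.NumberTheory.Automorphic.Liu2021.AppendixC
open Literature.NumberTheory.Automorphic.Liu2021.Def411WeilCarriers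
open Literature.NumberTheory.Automorphic.Liu2021.Def411WeilCarriersDoubling
open Literature.NumberTheory.Automorphic.Liu2021.CheckOfChi
open Literature.NumberTheory.Automorphic.IdeleClassGroup
open Literature.NumberTheory.GelbartRogawski1991 Literature.NumberTheory.GelbartRogawski1991.UnitaryDualPair
open Literature.NumberTheory.GelbartRogawski1991.UnitaryDualPair.WeilCoinv
open Literature.NumberTheory.GelbartRogawski1991.UnitaryDualPair.LocalSplitting
open Literature.RepresentationTheory Literature.RepresentationTheory.Liu2021
open Literature.NumberTheory.GaloisRepresentations Literature.RepresentationTheory.HarrisKudlaSweet1996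
open Literature.NumberTheory.Rogawski1990
open Summit.HodgeConjecture.CorCM
open Summit.HodgeConjecture.CorCM.Transposition
open Summit.HodgeConjecture.HodgeConjecture.Cruxes.H413

namespace Summit.HodgeConjecture.HodgeConjecture.Cruxes.H413.F0P2uMemXiFamilyThetaNonsplit

set_option synthInstance.maxHeartbeats 400000 in
set_option maxHeartbeats 16000000 in
/-- **THE NON-SPLIT MEMBERSHIP CLAUSE FOR THETA-TYPE `P`** (see the module docstring): at a non-split place `v`, for the dictionary `ξ` of `(μ, χ, μω)` (ANY `ξ` under
the two global pins), a form congruence `(T, a′)` and a pair `(x, s)` with `x ∈ JH(i_G(χ_{ξ,v}))`, `s` supercuspidal when present, such that every local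
constituent of `P` at `v` is `comap (cmDatumLocalCongr L v T ha h).symm x` or `s` — the non-split clause of `IsXiLocalFamily` for `Pv v := ⟨…, s⟩` plus the
`LocalConstituentsIn` clause at `v`.  [cite: Rogawski1990, §12.2 (2) p. 174; §13.1 p. 199, Prop. 13.1.3 (d); §13.3 p. 201]
[cite: GelbartRogawski1991, §5.1 (5.1.1) p. 465, Lem. 5.1.2 pp. 465–466; §5.2 p. 467] [cite: GelbartRogawski1990, Prop. 5.2.2] [cite: Flath1979, Thm. 3]
[cite: Liu2021, Def. 4.11 (l. 2090–2096); App. D §D.1 (l. 5224)] -/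
theorem nonsplit_clause_of_hasFinComponent_theta
    (L : Type) [Field L] [NumberField L] [IsCMField L] (H : Matrix (Fin 3) (Fin 3) L) (hH : (H.map (cmConjRingHom L))ᵀ = H) (hHd : IsUnit H.det)
    {n' : ℕ} (e₁ : Fin 3 × Fin 1 ≃ Fin n') (dV : Fin 3 → L) (hdV : ∀ i, IsCMField.complexConj L (dV i) = dV i) (hdV0 : ∀ i, dV i ≠ 0)
    (g : GL (Fin 3) L)
    (hg : ((g : Matrix (Fin 3) (Fin 3) L).map (cmConjRingHom L))ᵀ * H * (g : Matrix (Fin 3) (Fin 3) L) = Matrix.diagonal dV)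
    (ιV : finAdelic (↥(maximalRealSubfield L)) L (IsCMField.complexConj L) 3 H →*
        finAdelic (↥(maximalRealSubfield L)) L (IsCMField.complexConj L) 3 (Matrix.diagonal dV))
    (hιV : ∀ k, ((ιV k : finAdelic (↥(maximalRealSubfield L)) L (IsCMField.complexConj L) 3 (Matrix.diagonal dV)) :
          GL (Fin 3) (FiniteAdeleRing (𝓞 L) L)) =
        (toFinAdeleGL L 3 g)⁻¹ * (k : GL (Fin 3) (FiniteAdeleRing (𝓞 L) L)) * toFinAdeleGL L 3 g)
    (μA : Measure (adelicGroupData (↥(maximalRealSubfield L)) L (IsCMField.complexConj L) 3 H).automorphicQuotient)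
    [(adelicGroupData (↥(maximalRealSubfield L)) L (IsCMField.complexConj L) 3 H).IsAutomorphicMeasure μA]
    (P : DiscreteAutomorphicRep (adelicGroupData (↥(maximalRealSubfield L)) L (IsCMField.complexConj L) 3 H) μA)
    (μω : HeckeCharacter L) (hμu : μω.IsUnitary)
    (hquad : ∀ x : Literature.NumberTheory.GaloisRepresentations.ideleGroup ↥(maximalRealSubfield L),
      μω (AdeleRing.ideleBaseChange (↥(maximalRealSubfield L)) L x) = quadraticHeckeCharCM L x)
    (μ : Literature.NumberTheory.Automorphic.IdeleClassGroup L →ₜ* Circle) (hμ : IsConjugateSymplectic L μ)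
    (a : (↥(maximalRealSubfield L))ˣ) (χ : Chi (↥(maximalRealSubfield L)) L (IsCMField.complexConj L))
    (hfin : P.HasFinComponent
      (rhoAtLine (↥(maximalRealSubfield L)) L (IsCMField.complexConj L) 3 e₁ (Matrix.diagonal dV)
        (complexConj_imagUnit L) (imagUnit_ne_zero L) (imagUnit_mul_self L) (realDiagonal_isSymm L dV hdV)
        (isUnit_det_realDiagonal L dV hdV hdV0) (realDiagonal_map L dV hdV).symm
        (fun a => isCompatible_chiSplittingLine L e₁ dV hdV hdV0 (toHeckeCharacter L μ)
          (isUnitary_toHeckeCharacter L μ) ((isOscillatorChar_toHeckeCharacter_iff μ).mpr hμ)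
          (TW (↥(maximalRealSubfield L)) a) (isSymm_TW (↥(maximalRealSubfield L)) a)
          (isUnit_det_TW (↥(maximalRealSubfield L)) a) (JW (↥(maximalRealSubfield L)) L a)
          (JW_eq (↥(maximalRealSubfield L)) L a)) ιV a χ))
    (ξ : OneDimAutRepH L) (hcc : IsCMField.complexConj L * IsCMField.complexConj L = 1)
    (hμξ : toHeckeCharacter L μ = ξ.bcη⁻¹ * ξ.bcψ⁻¹ * μω)
    (hχξ : HeckeCharacter.checkOfChi hcc χ = ξ.bcψ⁻¹ * (ξ.bcη⁻¹ * ξ.bcψ⁻¹ * μω) ^ 2)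
    (v : HeightOneSpectrum (𝓞 ↥(maximalRealSubfield L))) (hv : ∀ w : PlacesOver L v, IsCMField.complexConj L • w.1 = w.1) :
    ∃ (T : GL (Fin 3) (UnitaryGroup.LocalRing L v)) (a' : UnitaryGroup.LocalRing L v) (ha : IsUnit a')
      (h : formCongr (conjLocal L (IsCMField.complexConj L) v) T (H.map (algebraMap L (UnitaryGroup.LocalRing L v))) =
        a' • (Matrix.of fun i j : Fin 3 => if i.val + j.val + 1 = 3 then (1 : L) else 0).map (algebraMap L (UnitaryGroup.LocalRing L v)))
      (x : IrrClass (Gqs L v)) (s : Option (IrrClass ((cmDatum L 3 H).Local v))),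
      x.IsConstituentOf (cmPrincipalSeries L 3 v (cmXiTorusChar L v (μω.semilocalComponent L v)
        (torusLocalComponent L (IsCMField.complexConj L) v ξ.η) (torusLocalComponent L (IsCMField.complexConj L) v ξ.ψ))) ∧
      (∀ c : IrrClass ((cmDatum L 3 H).Local v), s = some c → c.IsSupercuspidal) ∧
      ∀ c : IrrClass ((cmDatum L 3 H).Local v),
        (IrrClass.comap (localPiEquiv L (IsCMField.complexConj L) 3 H v) c).IsConstituentOf
            (P.finRep.smoothPart.toRepresentation.comp (inclPlace (↥(maximalRealSubfield L)) L (IsCMField.complexConj L) 3 H v)) →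
          c = IrrClass.comap (cmDatumLocalCongr L v T ha h).symm x ∨ s = some c := by
  have hχu := Def411WeilCarriers.norm_chi_eq_one_cm L χ
  -- the two dictionary pins in letter #76's literal shapes
  have hdμ : ∀ v : HeightOneSpectrum (𝓞 ↥(maximalRealSubfield L)),
      (toHeckeCharacter L μ).semilocalComponent L v = (ξ.bcη⁻¹ * ξ.bcψ⁻¹ * μω).semilocalComponent L v := fun v => by rw [hμξ]
  have hdχ : ∀ z : (FiniteAdeleRing (𝓞 L) L)ˣ,
      χ.1 (finAdelicCheck (↥(maximalRealSubfield L)) L (IsCMField.complexConj L)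
          (AlgEquiv.ext fun x => by rw [AlgEquiv.mul_apply, IsCMField.complexConj_apply_apply, AlgEquiv.one_apply]) z) =
        (ξ.bcψ⁻¹ * (ξ.bcη⁻¹ * ξ.bcψ⁻¹ * μω) ^ 2)
          (Units.map (N := AdeleRing (𝓞 L) L) (MonoidHom.inr (InfiniteAdeleRing L) (FiniteAdeleRing (𝓞 L) L)) z) := fun z => by
    have hfp : idelicFinPart L (Units.map (N := AdeleRing (𝓞 L) L) (MonoidHom.inr (InfiniteAdeleRing L) (FiniteAdeleRing (𝓞 L) L)) z) = z :=
      Units.ext rfl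
    rw [← hχξ, checkOfChi_apply, hfp]
  -- a form congruence at the non-split place
  obtain ⟨T, a', ha, h⟩ := Literature.NumberTheory.Rogawski1990.exists_formCongr_eq_smul_antidiag hH hHd v hv
  -- K1c at the line `a`: the transported theta type `πG_a` is irreducible and smooth
  obtain ⟨hirr, hsm, -⟩ := F0P2oXThetaOwnClass.stubK1c_holds L H hH hHd e₁ dV hdV hdV0 g hg μ hμ χ.1 χ.2.1 hχu v hv T a' ha h a
  -- the bundled class `x_a := ⟦πG_a⟧` on `U(Φ₃)(L⁺_v)` and its transport `c_a` to `U(H)(L⁺_v)`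
  set r_a : SmoothIrrep (Gqs L v) :=
    { V := _, ρ := (((xThetaCM L e₁ dV hdV hdV0 μ hμ χ.1 a v :
              localPi L (IsCMField.complexConj L) 3 (Matrix.diagonal dV) v →* _).comp
              (localCongr L (IsCMField.complexConj L) g one_ne_zero (by rw [one_smul]; exact hg) v).symm.toMulEquiv.toMonoidHom).comp
            ((cmDatumLocalCongr L v T ha h).trans (localPiEquiv L (IsCMField.complexConj L) 3 H v).symm).toMulEquiv.toMonoidHom),
      isIrreducible := hirr, isSmooth := hsm } with hr_a
  set c_a : IrrClass ((cmDatum L 3 H).Local v) := IrrClass.comap (cmDatumLocalCongr L v T ha h).symm (IrrClass.mk r_a) with hc_a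
  -- KEY: every local constituent of `P` at `v` IS `c_a`
  have hP : ∀ c : IrrClass ((cmDatum L 3 H).Local v),
      (IrrClass.comap (localPiEquiv L (IsCMField.complexConj L) 3 H v) c).IsConstituentOf
          (P.finRep.smoothPart.toRepresentation.comp (inclPlace (↥(maximalRealSubfield L)) L (IsCMField.complexConj L) 3 H v)) →
        c = c_a := by
    intro c hc
    have hirrρ := F0P2cStubCI.rhoAtLine_chi_isIrreducible L H e₁ dV hdV hdV0 g hg ιV hιV μ hμ a χ
    have hadm := F0P2cStubCI.rhoAtLine_chi_isAdmissible L H e₁ dV hdV hdV0 g hg ιV hιV μ hμ a χ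
    obtain ⟨hτ, hτtop⟩ := F0P2cOmegaLocalType.isLocalTypeAt_rhoAtLine_chi L H e₁ dV hdV hdV0 g hg ιV hιV μ hμ a χ v
    have htopP := F0P3FinPartIsotypic.isotypicComponent_finRep_smoothPart_eq_top P _ hirrρ hadm hfin
    haveI := hirrρ
    -- `c` read on `localPi v` is a constituent of the irreducible local type `τ_a`
    have h₁ := hc.of_isotypicComponent_eq_top_comp htopP (inclPlace (↥(maximalRealSubfield L)) L (IsCMField.complexConj L) 3 H v)
    have h₂ := F0P2rFamTransferHolds.isConstituentOf_of_isotypicComponent_eq_top hτtop h₁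
    -- `c_a` read on `localPi v` IS `τ_a` (its representation is the same function: `e ∘ e⁻¹ = id` twice)
    have hρ : ((r_a.comap (cmDatumLocalCongr L v T ha h).symm).comap (localPiEquiv L (IsCMField.complexConj L) 3 H v)).ρ =
        ((xThetaCM L e₁ dV hdV hdV0 μ hμ χ.1 a v :
            localPi L (IsCMField.complexConj L) 3 (Matrix.diagonal dV) v →* _).comp
          (localCongr L (IsCMField.complexConj L) g one_ne_zero (by rw [one_smul]; exact hg) v).symm.toMulEquiv.toMonoidHom) := by
      refine MonoidHom.ext fun u => ?_
      change (xThetaCM L e₁ dV hdV hdV0 μ hμ χ.1 a v)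
          ((localCongr L (IsCMField.complexConj L) g one_ne_zero (by rw [one_smul]; exact hg) v).symm
            ((localPiEquiv L (IsCMField.complexConj L) 3 H v).symm
              ((cmDatumLocalCongr L v T ha h) ((cmDatumLocalCongr L v T ha h).symm (localPiEquiv L (IsCMField.complexConj L) 3 H v u))))) =
        (xThetaCM L e₁ dV hdV hdV0 μ hμ χ.1 a v)
          ((localCongr L (IsCMField.complexConj L) g one_ne_zero (by rw [one_smul]; exact hg) v).symm u)
      rw [ContinuousMulEquiv.apply_symm_apply, ContinuousMulEquiv.symm_apply_apply]
    have h₃ : (IrrClass.comap (localPiEquiv L (IsCMField.complexConj L) 3 H v) c_a).IsConstituentOf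
        ((xThetaCM L e₁ dV hdV hdV0 μ hμ χ.1 a v :
            localPi L (IsCMField.complexConj L) 3 (Matrix.diagonal dV) v →* _).comp
          (localCongr L (IsCMField.complexConj L) g one_ne_zero (by rw [one_smul]; exact hg) v).symm.toMulEquiv.toMonoidHom) := by
      have hself := IrrClass.isConstituentOf_mk_self
        ((r_a.comap (cmDatumLocalCongr L v T ha h).symm).comap (localPiEquiv L (IsCMField.complexConj L) 3 H v))
      rw [hρ] at hself
      -- `comap e ⟦r⟧ = ⟦r.comap e⟧` definitionally (★ `IrrClass.comap_mk` is `rfl`)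
      exact hself
    haveI := hτ
    exact IrrClass.comap_injective (localPiEquiv L (IsCMField.complexConj L) 3 H v) (h₂.eq_of_isIrreducible h₃)
  -- case split on the supercuspidality of Liu's local theta type at the line `a`
  by_cases hsc : (xThetaCM L e₁ dV hdV hdV0 μ hμ χ.1 a v).IsSupercuspidal
  · /- SUPERCUSPIDAL: `πˢ := some c_a`, `πⁿ := x₀` of ★ #76 -/
    obtain ⟨x₀, hx₀, -⟩ := F0P2oLocalLettersHold.GR91Lemma512NonsplitAsPrinted_holds L H hH hHd e₁ dV hdV hdV0 g hg ξ μω hμu hquad μ hμ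
      χ.1 χ.2.1 hχu hdμ hdχ v hv T a' ha h
    have hX : Representation.IsSupercuspidal (V := _)
        ((((xThetaCM L e₁ dV hdV hdV0 μ hμ χ.1 a v :
              localPi L (IsCMField.complexConj L) 3 (Matrix.diagonal dV) v →* _).comp
              (localCongr L (IsCMField.complexConj L) g one_ne_zero (by rw [one_smul]; exact hg) v).symm.toMulEquiv.toMonoidHom).comp
            ((cmDatumLocalCongr L v T ha h).trans (localPiEquiv L (IsCMField.complexConj L) 3 H v).symm).toMulEquiv.toMonoidHom)) :=
      (F0P2rCuspDictHolds.isSupercuspidal_comp_toMonoidHom_iff _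
          ((cmDatumLocalCongr L v T ha h).trans (localPiEquiv L (IsCMField.complexConj L) 3 H v).symm)).2
        ((F0P2rCuspDictHolds.isSupercuspidal_comp_toMonoidHom_iff (xThetaCM L e₁ dV hdV hdV0 μ hμ χ.1 a v)
          (localCongr L (IsCMField.complexConj L) g one_ne_zero (by rw [one_smul]; exact hg) v).symm).2 hsc)
    have hsc_a : c_a.IsSupercuspidal :=
      IrrClass.IsSupercuspidal.comap (cmDatumLocalCongr L v T ha h).symm ((IrrClass.isSupercuspidal_mk r_a).2 hX)
    refine ⟨T, a', ha, h, x₀, some c_a, hx₀, ?_, fun c hc => Or.inr (by rw [hP c hc])⟩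
    rintro c hc
    rw [Option.some.injEq] at hc
    rw [← hc]
    exact hsc_a
  · /- NOT SUPERCUSPIDAL: `πˢ := none`, `πⁿ := c_a`, and `⟦πG_a⟧ ∈ JH(i_G(χ_ξ))` by the K1 chain at the line `a` -/
    -- a line-independent centre character
    obtain ⟨ψθ, hψθ⟩ := F0P2oK1aWOfLetters.exists_forall_isThetaCenterChar L μ χ.1 v
    -- [GelbartRogawski1990 Prop. 5.2.2] (N3 ★, N6 ★): not supercuspidal ⟹ `ψθ` occurs in `ω¹_a`
    have h522 := F0P2oGR90Prop522OfLetters.GR90Prop522_of_letters F0P2oLineJacquetHolds.thetaType_nonsplit_jacquetModule_holds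
      Literature.NumberTheory.Rogawski1990.u3_isSupercuspidal_iff_jacquet_eq_zero_holds L e₁ dV hdV hdV0
      (Equiv.prodUnique (Fin 1) (Fin 1)) μ hμ χ.1 χ.2.1 hχu v hv a ψθ (hψθ a)
    have hocc : OccursInLineWeilCM L (Equiv.prodUnique (Fin 1) (Fin 1)) (kernelLineCM dV) (complexConj_kernelLineCM dV hdV)
        (kernelLineCM_ne_zero dV hdV0) μ hμ a v ψθ := by
      by_contra hn
      exact hsc (h522.2 hn)
    -- N3ᵟ ★: the non-zero `(B, χθʷ·δ_B^{1/2})`-eigenfunctional on `πG_a`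
    obtain ⟨ℓ, hℓ0, hℓ⟩ := F0P2oBorelEigenfunctionalOfJacquetModule.thetaType_nonsplit_borelEigenfunctional_of_jacquetModule
      F0P2oLineJacquetHolds.thetaType_nonsplit_jacquetModule_holds L H hH hHd e₁ dV hdV hdV0 g hg (Equiv.prodUnique (Fin 1) (Fin 1))
      μ hμ χ.1 χ.2.1 hχu v hv T a' ha h a ψθ (hψθ a) hocc
    -- K1b ★ Frobenius: `⟦πG_a⟧ ∈ JH(i_G(χθʷ))`; K1w ★: `∈ JH(i_G(χθ))`
    have hθw := F0P2nFrobeniusFunctional.isConstituentOf_mk_cmPrincipalSeries_xi_of_functional L v _ ψθ⁻¹ ψθ _ hirr hsm ℓ hℓ hℓ0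
    have hθ := F0P2oK1wOfWeylConj.stubK1w_of_weylConj F0P2pK1wHolds.cmPrincipalSeries_isConstituentOf_weylConj_holds
      L H hH hHd e₁ dV hdV hdV0 g hg μ hμ χ.1 χ.2.1 hχu v hv T a' ha h ψθ _ hθw
    -- K2 ★: the dictionary at the pins, `i_G(χ_ξ) = i_G(χθ)`
    have hdict := F0P2oStubDictTorusChar.stubDictTorusChar_holds L ξ μω hμu hquad μ hμ χ.1 χ.2.1 hχu hdμ hdχ v hv a ψθ (hψθ a)
    refine ⟨T, a', ha, h, IrrClass.mk r_a, none, ?_, fun c hc => (Option.some_ne_none c hc.symm).elim, fun c hc => Or.inl ?_⟩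
    · rw [hdict]
      exact hθ
    · rw [hP c hc]

end Summit.HodgeConjecture.HodgeConjecture.Cruxes.H413.F0P2uMemXiFamilyThetaNonsplit

end
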